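import Literature.Probability.RandomPlanarGeometry.ConformalMapCaratheodoryProofs
import Literature.Probability.RandomPlanarGeometry.ChordalBoundary
import HarnessLib

/-!
# Inverse boundary correspondence for Jordan domains (half-plane form)

Topic `Literature/Probability/RandomPlanarGeometry`; a complement to the Carathéodory files
(`ConformalMapCaratheodoryProofs.lean`: `JordanDomain.exists_continuousOn_extension_holds`,
Pommerenke (1992) Thm. 2.6, proved; `CaratheodoryHalfPlane.lean`: the Cayley reduction).
Everything here is proved; no named facts.

Carathéodory's theorem makes the disc extension `Ψ` of `φ ∘ cayley⁻¹` a continuous BIJECTION of the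
closed disc onto `closure D`; being a continuous injection of a compact space into a Hausdorff one
it is a homeomorphism, so the INVERSE map is continuous up to the boundary as well. In the
half-plane form used by the lattice-model files (uniformizing maps `φ : ℍₒ → D`):

* `JordanDomain.tendsto_symm_nhdsWithin_boundaryExtension` — **`φ⁻¹ w → x` as `w → φ̃(x)` within
  `D`**, for every real `x` (`φ̃ = φ.boundaryExtension`);
* `JordanDomain.exists_tendsto_symm_of_mem_image` — the form consumed by harmonic-measure
  estimates of boundary arcs (`Literature.Analysis.Potential.harmonicMeasure_le_of_harmonicOnNhd` and
  its half-plane specialisation in `Literature/Probability/LatticeModels/FKIsingQuadrilateralCrossingHarmonicMeasure.lean`):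
  at every point of the arc `φ̃((α, β))` the inverse map tends to a point of `(α, β)`.

## References
* [PommerenkeBBCM1992] Ch. Pommerenke, *Boundary Behaviour of Conformal Maps* (1992), Thm. 2.6
  (and §1.2 for the Cayley transform).
-/

noncomputable section

open Set Filter Metric Topology Complex
open UpperHalfPlane (upperHalfPlaneSet)

namespace Literature.Probability.RandomPlanarGeometry

namespace JordanDomain

variable (D : JordanDomain) (φ : ConformalEquiv upperHalfPlaneSet D.carrier)

/-- **Inverse boundary correspondence (Carathéodory, half-plane form).** For a conformal
equivalence `φ : ℍₒ → D` onto a Jordan domain and a real point `x`, the inverse map satisfies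
`φ⁻¹ w → x` as `w → φ.boundaryExtension x` within `D`: the disc extension of `φ ∘ cayley⁻¹` is a
continuous bijection of the closed disc onto `closure D` (Thm. 2.6), hence a homeomorphism, and its
inverse composed with `cayley⁻¹` is continuous at `cayleyFun x ≠ 1`.
[cite: PommerenkeBBCM1992, Thm. 2.6] -/
theorem tendsto_symm_nhdsWithin_boundaryExtension (x : ℝ) :
    Tendsto φ.symm (𝓝[D.carrier] (φ.boundaryExtension x)) (𝓝 (x : ℂ)) := by
  obtain ⟨Ψ, hΨc, hΨeq, hbij, -⟩ := exists_continuousOn_extension_holds D (cayley.symm.trans φ)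
  -- the inverse `g` of `Ψ` on the closed disc is continuous on `closure D`
  set g : ℂ → ℂ := Function.invFunOn Ψ (closedBall (0 : ℂ) 1) with hg
  have hgc : ContinuousOn g (closure D.carrier) := by
    have := IsCompact.continuousOn_invFunOn (isCompact_closedBall (0 : ℂ) 1) hΨc hbij.injOn
    rwa [hbij.image_eq] at this
  have hg_eq : ∀ {w p : ℂ}, p ∈ closedBall (0 : ℂ) 1 → Ψ p = w → g w = p := by
    intro w p hp hpw
    have hw' : ∃ a ∈ closedBall (0 : ℂ) 1, Ψ a = w := ⟨p, hp, hpw⟩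
    exact hbij.injOn (Function.invFunOn_mem hw') hp ((Function.invFunOn_eq hw').trans hpw.symm)
  -- on `D`, `g = cayleyFun ∘ φ⁻¹`
  have hgD : ∀ w ∈ D.carrier, g w = cayleyFun (φ.symm w) := by
    intro w hw
    have h1 : φ.symm w ∈ upperHalfPlaneSet := φ.symm_mapsTo hw
    refine hg_eq (ball_subset_closedBall (cayley.mapsTo h1)) ?_
    have h2 : Ψ (cayleyFun (φ.symm w)) = (cayley.symm.trans φ) (cayleyFun (φ.symm w)) :=
      hΨeq (cayley.mapsTo h1)
    rw [h2, ConformalEquiv.trans_apply, cayley_symm_apply,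
      cayleyInvFun_cayleyFun (add_I_ne_zero h1.le), φ.apply_symm_apply hw]
  -- the boundary point and its `g`-image
  have hxB : cayleyFun (x : ℂ) ∈ closedBall (0 : ℂ) 1 :=
    mem_closedBall_zero_iff.2 (norm_cayleyFun_ofReal x).le
  have hζeq : φ.boundaryExtension x = Ψ (cayleyFun x) :=
    boundaryExtension_eq_of_extension φ hΨc hΨeq (x := x) (by simp)
  have hζcl : φ.boundaryExtension x ∈ closure D.carrier := by
    rw [hζeq]; exact hbij.mapsTo hxB
  have hgζ : g (φ.boundaryExtension x) = cayleyFun x := hg_eq hxB hζeq.symm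
  -- continuity of `g` at the boundary point, restricted to `D`
  have hg_t : Tendsto g (𝓝[D.carrier] (φ.boundaryExtension x)) (𝓝 (cayleyFun x)) := by
    have := (hgc _ hζcl).tendsto
    rw [hgζ] at this
    exact this.mono_left (nhdsWithin_mono _ subset_closure)
  -- compose with `cayleyInvFun`, continuous at `cayleyFun x ≠ 1` (`1` corresponds to `∞`)
  have hne : cayleyFun (x : ℂ) ≠ 1 := by
    intro h
    rw [cayleyFun_apply, div_eq_one_iff_eq (add_I_ne_zero (by simp))] at h
    have := congrArg Complex.im h
    norm_num at this
  have hinv : ContinuousAt cayleyInvFun (cayleyFun x) :=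
    differentiableOn_cayleyInvFun.continuousOn.continuousAt (isOpen_ne.mem_nhds hne)
  have hcomp := hinv.tendsto.comp hg_t
  rw [cayleyInvFun_cayleyFun (add_I_ne_zero (by simp : (0 : ℝ) ≤ ((x : ℂ)).im))] at hcomp
  refine hcomp.congr' ?_
  filter_upwards [self_mem_nhdsWithin] with w hw
  rw [Function.comp_apply, hgD w hw, cayleyInvFun_cayleyFun (add_I_ne_zero (φ.symm_mapsTo hw).le)]

/-- **Boundary correspondence on an arc, inverse form**: at every point of the arc
`φ.boundaryExtension '' (α, β)` of `∂D`, the inverse map `φ⁻¹` tends (within `D`) to a point of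
`(α, β)` — the hypothesis under which the harmonic measure of the arc is dominated by the angle
subtended by `(α, β)` (`harmonicMeasure_le_of_harmonicOnNhd` with the majorant
`ω_ℍ(·; (α, β)) ∘ φ⁻¹`). [cite: PommerenkeBBCM1992, Thm. 2.6] -/
theorem exists_tendsto_symm_of_mem_image {α β : ℝ} {ζ : ℂ}
    (hζ : ζ ∈ φ.boundaryExtension '' ((fun x : ℝ ↦ (x : ℂ)) '' Ioo α β)) :
    ∃ x : ℝ, α < x ∧ x < β ∧ Tendsto φ.symm (𝓝[D.carrier] ζ) (𝓝 (x : ℂ)) := by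
  obtain ⟨z, ⟨x, ⟨hαx, hxβ⟩, rfl⟩, rfl⟩ := hζ
  exact ⟨x, hαx, hxβ, tendsto_symm_nhdsWithin_boundaryExtension D φ x⟩

/-- Points of the arc `φ.boundaryExtension '' (α, β)` lie on `∂D`. [cite: PommerenkeBBCM1992, Thm. 2.6] -/
theorem image_boundaryExtension_subset_frontier {α β : ℝ} :
    φ.boundaryExtension '' ((fun x : ℝ ↦ (x : ℂ)) '' Ioo α β) ⊆ frontier D.carrier := by
  rintro ζ ⟨z, ⟨x, -, rfl⟩, rfl⟩
  obtain ⟨Ψ, hΨc, hΨeq, -, hbij'⟩ := exists_continuousOn_extension_holds D (cayley.symm.trans φ)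
  rw [boundaryExtension_eq_of_extension φ hΨc hΨeq (x := x) (by simp)]
  exact hbij'.mapsTo (mem_sphere_zero_iff_norm.2 (norm_cayleyFun_ofReal x))

end JordanDomain

end Literature.Probability.RandomPlanarGeometry
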